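import Summits.QuantumFields.YangMills.Theorems.BalabanUVNodesN07SplitClauseOfPureGaugeShift
import Summits.QuantumFields.YangMills.Theorems.UnitScaleTiltProp8FlatCubeLevels
import HarnessLib

/-!
# N07 [B11] (= [15] = [Balaban1985Variational]) Sect. F, road of record R0′, WIDTH-209 row (r2), FILE 5: **THE `Q(∂μ)`-FORM OF A MULTI-LEVEL
# COARSE PURE GAUGE** — the level lift `μ_λ` of a coarse family `λ = (λ_j)_j`, the exact `Q`-form on the interior `Λ_j`-cells, the defect
# carried by the OUTER cells of print's (2.3) star convention, outer-consistency ⇒ `X = Q(∂μ)` (the `hXM` binder of FILE 3 ∕ of dag-n07-w7's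
# `H(Q∂μ₀) = ∂(μ₀ − n)`), and the split `∂(H_V X) = ∂(H_V X_∂)` — LOCATED-QFORM (cell bus I.31074) made a name

Cell `pub-ymgap`, width seat `pub-ymgap-dag-n07-w8` g3, WIDTH-209 N07 row (r2) of road R0′ (TABLE v67 «(r2) n07-w8»), CLAIM-5 ∕ INTENT-5 (cell bus
I.34870).  `--kind proof --supports stmt-QuantumFields-26907 --as helper` (K1⁸ per KEY MAP v1.65); count-neutral; def-free.
[15] = T. Bałaban, *The variational problem and background fields in renormalization group method for lattice gauge theories*, Commun. Math. Phys.
**102** (1985) 277–309 [Balaban1985Variational]; [4] = [Balaban1984PropagatorsII] (CMP **96** (1984) 223–250); [I.4] = [Balaban1984PropagatorsI] (CMP **95**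
(1984) 17–40).

THE SEAM (LOCATED-QFORM, this seat g2, cell bus I.31074; dag-n07-e `STUB1-SECTF-MAP.md` § R0′-ASSEMBLY «(164)∕(167) letters shifted by ∂μ → (r2)»).  Under road
R0′ the datum of the Landau copy on a level-`j` cell `c` is `log V″(c) + (λ_j(c₋) − λ_j(c₊)) + N₂(c)` with the COARSE gauge family `λ_j = log ∘ S_j(U₁)`
(dag-n07-w7 p609976, dag-n07-w6 p612112): the shift summand is the coarse pure gauge `X(c) = ∂^{(j)}λ_j(c)`.  Both doors that turn it into a FINE pure gauge
`G = H(X) = ∂μ` — dag-n07-w7's `N07FlatHOfCoarseGradient.hOp_QE_dE_eq_dE_V1` («for every scalar `μ₀`, `H(Q(∂μ₀)) = ∂(μ₀ − n)`») and FILE 3's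
`N07PureGaugeShiftLetters.curlA_extension_eq_zero_of_bondAvgIter_grad` (binder `hXM : X(c) = (Q_{j(c)}(∂^{c₀}M))(c)`) — ask for ONE fine gauge function
whose multi-level averages reproduce the family: by [I.4] (1.20) `Q_j∂ = ∂^{(j)}Q′_j`, this means `Q′_jμ₀ = λ_j` at the END-POINTS of the `Λ_j`-cells.
[4] p. 224 (2.3) takes `Λ_j` as a set of BONDS with the star convention *«Ω also the set of bonds ⋃_{x∈Ω} st(x) = {bonds b: at least one end-point of b
belongs to Ω}»* (lit-balaban `B6SectADomainsV1.Domains.LamBond`: at least one end-point in `Ω_j^{(j)}`, none inside `Ω_{j+1}`), so a `Λ_j`-cell may have ONE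
end-point `y_out ∉ Ω_j^{(j)}`; there (1.20) forces `λ_j(y_out) = Q′_jμ₀(y_out)`, a condition on the FAMILY (automatic for block-mean families `λ_j = Q′_jM`,
[I.4] (1.20); not for general centre-evaluation families).  This file types the bookkeeping once, for values in ANY real vector space `V` (so for `ℝ` and
for `M_N(ℂ)` at once).

WHAT IS PROVED (sorry-free; no definition; axioms standard; all BY NAME over lit-balaban's V1 multi-level calculus `LatticeFieldCalculus` ∕ `B5Eq118OneStroke` ∕
`B5Eq120IterProof` ∕ `B6SectADomainsV1` ∕ `B6SectAOperatorsV1` and ym3-torus `FlatCubeLevels`).  `D : Domains P` any nested family, `𝔅 = BondIdx D`.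
* §1 THE LEVEL LIFT.  `μ_λ(x) := λ_{j(x)}(Bʲ⁽ˣ⁾-point of x)` with `j(x)` = lit-balaban `B11Eq115Space.levOf` of `D`'s territories ([4] (2.4) «T = ⋃_j Bʲ(Λ_j)»,
  ym3-torus `levOf_inOm_eq_iff`): `levLift_apply_of_lamSite`, ★ `siteAvgIter_levLift` (`y ∈ Λ_j ⇒ Q′_jμ_λ(y) = λ_j(y)` — (1.20) one-stroke
  `siteAvgIter_eq_blockSum` + `card_iterBlock`), `siteAvgIter_levLift_succ_of_block_lamSite` (over a block of `Λ_j`-sites `Q′_{j+1}μ_λ = Q′λ_j`: the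
  outer-cell defect of §2 is then `±(c₀∕L^{j+1})•(λ_{j+1}(y_out) − (Q′λ_j)(y_out))`, a letter of the family alone), `exists_fine_siteAvgIter_eq_on_lamSite` (the `V`-valued twin of lit-balaban's ℝ-valued
  `B6SectAOntoV1.exists_siteAvgIter_eq_on_lamSite` — cited, not restated: there `Q′` onto `L²(𝔅)` by `Σ_j` of `pull`-lifts).
* §2 THE DEFECT ON ONE CELL (hypothesis form: ANY `μ` with `Q′_jμ = λ_j` on `Λ_j`).  `coarseGrad_sub_bondAvgIter_grad` ((1.20): `∂^{(j)}λ_j(b) − Q_j(∂^{c₀}μ)(b) =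
  (c₀∕Lʲ)•((λ_j − Q′_jμ)(b₊) − (λ_j − Q′_jμ)(b₋))`, no hypothesis), ★ `bondAvgIter_grad_eq_coarseGrad_of_lamSite` ∕ `…_of_mem_Om` (BOTH end-points in `Ω_j^{(j)}` ⇒ the
  cell's coarse gradient IS `Q_j(∂μ)(b)`: interior cells exact), `coarseGrad_sub_bondAvgIter_grad_of_src_lamSite` ∕ `…_of_tgt_lamSite` ∕ `…_of_src_not_mem` ∕
  `…_of_tgt_not_mem` (a `Λ_j`-cell with its one outer end-point `y_out` carries exactly `±(c₀∕Lʲ)•(λ_j(y_out) − Q′_jμ(y_out))`).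
* §3 ON `𝔅`: ★★ `bondAvgIter_grad_eq_of_outerConsistent` (OUTER-CONSISTENCY `Q′_jμ(y_out) = λ_j(y_out)` at the outer end-points ⇒ `X = Q(∂^{c₀}μ)` on ALL of `𝔅` —
  the `hXM` binder; `bondAvgIter_grad_levLift_eq_of_outerConsistent` its edition with `μ := μ_λ`; `outerConsistent_of_blockMean`: block-mean families
  `λ_j = Q′_jM` qualify by `rfl` — non-vacuity (A6) and the [I.4] (1.20) case), `sub_bondAvgIter_grad_eq_zero_of_mem_Om` ∕ `sub_bondAvgIter_grad_of_src_not_mem` ∕ `…_of_tgt_not_mem` (the defect datum `X − Q(∂μ)` vanishes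
  on interior cells and has §2's values on outer cells).
* §4 AT NODE 00's OBJECTS (`V := M_N(ℂ)`, `c₀ := Lᵏ`, `H_V` the componentwise extension of k0-s1-w3's `flatH`): ★★ `curlA_extension_eq_curlA_extension_sub`
  (for EVERY fine matrix gauge function `M`: `∂^{η_k}(H_V X) = ∂^{η_k}(H_V(X − Q(∂^{Lᵏ}M)))` — FILE 3 ∘ g0's `curlA_add_eq_of_curlFree`; with `M := μ_λ` the
  right-hand datum is §3's outer-cell defect: LOCATED-QFORM's «rides in `A₀`» as a NAMED bond field), ★★
  `curlA_extension_eq_zero_of_coarseGradient_outerConsistent` (outer-consistent family ⇒ `∂^{η_k}(H_V X) = 0`, ∘ FILE 3), ★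
  `localGaugeSplitOn_of_gauge152_coarseGradient_outerConsistent` (∘ FILE 4 §1: the S6 head's R0′ clause `LocalGaugeSplitOn` with the shift taken from
  an outer-consistent coarse family — no `M` binder left on the head's side).
HONEST SCOPE.  Count-neutral multi-level torus bookkeeping ((1.20), (2.3)–(2.4)); whether the record's `λ_j = log ∘ S_j(U₁)` is outer-consistent (or how
its defect is sized — first order in the datum on the boundary cells of each `Λ_j`, rows (r4)∕(r4-rec)) is NOT decided here; nothing of [15]∕[6]∕[4]
ANALYSIS asserted; `LocalLettersSplitTopStepCore` ∕ `DatumGaugeSplitTopStepCore` ∕ `HalvingStepTop(Core)` ∕ `stub_prop8StepCoP13` NOT discharged; K0⁷ ∕ K1⁸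
NOT closed; N07 NOT discharged; counts unmoved (typed 28∕28 · discharged 5∕27); one finite 𝕋⁴ programme at fixed ε — the route closes the conditional
finite-𝕋⁴ rung `BalabanLadder.UV` ONLY; the YM mass gap (Clay) is NOT proved by any of this; nothing continuum ∕ ℝ⁴ ∕ OS.  No `sorry`, no `def`, no
`instance`, no `notation`.

RELATED IN THE TREE, NOT DUPLICATED (stem check 2026-08-28T09:16Z: `ls …/Theorems | rg -i 'QForm|CoarseGauge'` = ∅; `rg 'levLift|outerConsistent|
coarseGrad_sub_bondAvgIter|curlA_extension_eq_curlA_extension'` over lean∕ = ∅): lit-balaban `B6SectAOntoV1` (§1 `Q′` onto, ℝ-valued, `pull`-lifts —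
CITED; the `V`-valued level lift via `levOf` is new and serves matrix families), `B6SectADomainsV1` ((2.3)–(2.4), Lemmas S∕V — CONSUMED), `B5Eq120IterProof`
((1.20) — CONSUMED); ym3-torus `FlatCubeLevels` (`levOf` = territory — CONSUMED); k0-s1-w1 `…K0Stub1FlatAveragingDictionary(Levels)` ∕ `…TouchedCentresOfDomains`
(record ↔ print KERNEL dictionaries and the level structure of touched cells — disjoint statements); FILE 3 `N07PureGaugeShiftLetters` ∕ FILE 4
`N07SplitClauseOfPureGaugeShift` (the curl binder with `hXM` DISPLAYED — CONSUMED here, `hXM` SUPPLIED); dag-n07-w7 `N07FlatHOfCoarseGradient` ∕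
`N07FlatHFeasibility` (abstract feasibility; §4 `H(Q∂μ₀) = ∂(μ₀ − n)` for every `μ₀` — its `μ₀` is §3's `μ`).

References: [4] (2.1)–(2.4) p. 224, (2.6)–(2.7) p. 224, (2.20) p. 226, (2.35) p. 228; [I.4] (1.13) p. 19, (1.18)–(1.20) p. 20; [15] p. 286 (levels of (115)),
(152) p. 301, (157)–(159) pp. 302–303, (164)–(165) p. 304, (168) p. 304.
-/

set_option autoImplicit false

noncomputable section
open scoped BigOperators Matrix.Norms.L2Operator

namespace Summit.QuantumFields.YangMills.BalabanUVNodes.N07CoarseGaugeQForm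

open Literature.MathematicalPhysics.QuantumFieldTheory.Balaban1983to89
open Literature.MathematicalPhysics.QuantumFieldTheory.Balaban1983to89.Node00
open Literature.MathematicalPhysics.QuantumFieldTheory.Balaban1983to89.B12RegularSpaces111 (gaugeU expI)
open LatticeFieldCalculus (grad siteAvg siteAvgIter bondAvgIter siteAvg_eq_blockSum)
open B5Eq118OneStroke (iterBlockOf iterBlock mem_iterBlock card_iterBlock siteAvgIter_eq_blockSum)
open B5Eq120IterProof (bondAvgIter_grad siteAvgIter_succ)
open B6SectADomainsV1 (Domains)
open B6SectAOperatorsV1 (BondIdx)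
open B11Eq115Space (levOf)
open Summit.QuantumFields.YangMills.Theorems.FlatCubeLevels (levOf_inOm_unique)
open Summit.QuantumFields.YangMills.Theorems.K0FlatCubeOpsTextP (flatH)
open Summit.QuantumFields.YangMills.BalabanUVNodes.N07HalvingStepTopOfLocalLetters (Letters10On)
open Summit.QuantumFields.YangMills.BalabanUVNodes.N07LocalLettersSplitCore (LocalGaugeSplitOn)
open Summit.QuantumFields.YangMills.BalabanUVNodes.N07PureGaugeShift168 (curlA_add_eq_of_curlFree)
open Summit.QuantumFields.YangMills.BalabanUVNodes.N07PureGaugeShiftLetters (curlA_extension_eq_zero_of_bondAvgIter_grad)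
open Summit.QuantumFields.YangMills.BalabanUVNodes.N07SplitClauseOfPureGaugeShift (localGaugeSplitOn_of_gauge152_coarsePureGauge)

variable {P : Params} {V : Type*} [AddCommGroup V] [Module ℝ V]

/-! ## §1  The level lift `μ_λ` of a multi-level coarse family -/

section Lift

variable (D : Domains P)

omit [AddCommGroup V] [Module ℝ V] in
/-- dependent-index bookkeeping: `λ_i(Bⁱ-point of x) = λ_j(Bʲ-point of x)` for `i = j`. [cite: Balaban1984PropagatorsII, (2.4) p.224 (bookkeeping)] -/
private theorem lam_congr (lam : (j : ℕ) → Site P j → V) (x : Site P 0) {i j : ℕ} (h : i = j) :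
    lam i (iterBlockOf i x) = lam j (iterBlockOf j x) := by
  subst h
  rfl

omit [AddCommGroup V] [Module ℝ V] in
/-- **THE LEVEL LIFT AT A SITE OVER `Λ_j`**: if the `j`-block of the fine site `x` lies in `Λ_j = Ω_j^{(j)} ∖ Ω_{j+1}^{(j)}`, then `j` is the level
`j(x)` (ym3-torus `levOf_inOm_unique` = [4] (2.4) disjointness) and `μ_λ(x) = λ_j(Bʲ-point of x)`. [cite: Balaban1984PropagatorsII, (2.3)–(2.4) p.224; Balaban1985Variational, p.286] -/
theorem levLift_apply_of_lamSite (lam : (j : ℕ) → Site P j → V) {x : Site P 0} {j : ℕ} (hx : D.LamSite j (iterBlockOf j x)) :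
    lam (levOf (fun i => {z : Site P 0 | D.InOm i z}) D.k x) (iterBlockOf (levOf (fun i => {z : Site P 0 | D.InOm i z}) D.k x) x)
      = lam j (iterBlockOf j x) :=
  lam_congr lam x (levOf_inOm_unique D hx)

/-- ★ **THE LEVEL LIFT REPRODUCES THE FAMILY ON `Λ_j`**: for `y ∈ Λ_j` (sites), `(Q′_jμ_λ)(y) = λ_j(y)` — `μ_λ` is constant `= λ_j(y)` on the block
`Bʲ(y)` (every `x ∈ Bʲ(y)` has level `j`), and `Q′_j` reproduces block constants ([I.4] (1.20) one-stroke `siteAvgIter_eq_blockSum`, `|Bʲ(y)| = L^{jd}`).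
[cite: Balaban1984PropagatorsI, (1.20) p.20, (1.15) p.19; Balaban1984PropagatorsII, (2.3)–(2.4) p.224] -/
theorem siteAvgIter_levLift (lam : (j : ℕ) → Site P j → V) {j : ℕ} {y : Site P j} (hy : D.LamSite j y) :
    siteAvgIter j (fun x => lam (levOf (fun i => {z : Site P 0 | D.InOm i z}) D.k x)
      (iterBlockOf (levOf (fun i => {z : Site P 0 | D.InOm i z}) D.k x) x)) y = lam j y := by
  have hj : j ≤ P.m + P.K := (D.le_of_lamSite hy).trans D.hk
  rw [siteAvgIter_eq_blockSum j hj]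
  have hconst : ∀ x ∈ iterBlock j y, lam (levOf (fun i => {z : Site P 0 | D.InOm i z}) D.k x)
      (iterBlockOf (levOf (fun i => {z : Site P 0 | D.InOm i z}) D.k x) x) = lam j y := by
    intro x hx
    rw [mem_iterBlock] at hx
    have hx' : D.LamSite j (iterBlockOf j x) := by rw [hx]; exact hy
    rw [levLift_apply_of_lamSite D lam hx', hx]
  rw [Finset.sum_congr rfl hconst, Finset.sum_const, card_iterBlock j hj, ← Nat.cast_smul_eq_nsmul ℝ, smul_smul]
  have hL : (((P.L : ℝ) ^ P.d) ^ j) ≠ 0 := pow_ne_zero _ (pow_ne_zero _ (Nat.cast_ne_zero.mpr P.L_pos.ne'))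
  rw [Nat.cast_pow, Nat.cast_pow, inv_mul_cancel₀ hL, one_smul]

/-- **THE LEVEL LIFT ONE LEVEL UP, OVER A BLOCK OF `Λ_j`-SITES**: if every `j`-block point of the `(j+1)`-block `B(y)` lies in `Λ_j` (the situation of an
OUTER end-point `y = y_out ∉ Ω_{j+1}^{(j+1)}` of a `Λ_{j+1}`-cell under [4] (2.2)'s separation), then `(Q′_{j+1}μ_λ)(y) = (Q′λ_j)(y)`, the one-step block mean of
the level below — so by §2 the defect carried by that cell is `±(c₀∕L^{j+1})•(λ_{j+1}(y_out) − (Q′λ_j)(y_out))`, a letter of the FAMILY alone (zero for block-mean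
families, [I.4] (1.20)). [cite: Balaban1984PropagatorsI, (1.13) p.19, (1.20) p.20; Balaban1984PropagatorsII, (2.2)–(2.4) p.224] -/
theorem siteAvgIter_levLift_succ_of_block_lamSite (lam : (j : ℕ) → Site P j → V) {j : ℕ} (hj : j + 1 ≤ P.m + P.K) {y : Site P (j + 1)}
    (hy : ∀ z ∈ block y, D.LamSite j z) :
    siteAvgIter (j + 1) (fun x => lam (levOf (fun i => {z : Site P 0 | D.InOm i z}) D.k x)
      (iterBlockOf (levOf (fun i => {z : Site P 0 | D.InOm i z}) D.k x) x)) y = siteAvg (lam j) y := by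
  rw [siteAvgIter_succ, siteAvg_eq_blockSum hj, siteAvg_eq_blockSum hj]
  congr 1
  exact Finset.sum_congr rfl fun z hz => siteAvgIter_levLift D lam (hy z hz)

/-- **A FINE GAUGE FUNCTION WITH PRESCRIBED MULTI-LEVEL AVERAGES ON THE `Λ_j` EXISTS, `V`-VALUED** (the twin, for values in any real vector space
— e.g. `M_N(ℂ)` — of lit-balaban's ℝ-valued `B6SectAOntoV1.exists_siteAvgIter_eq_on_lamSite` «`Q′` onto `L²(𝔅)`», here witnessed by the level lift).
[cite: Balaban1984PropagatorsII, (2.14)–(2.17) p.225, (2.4) p.224; Balaban1984PropagatorsI, (1.20) p.20] -/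
theorem exists_fine_siteAvgIter_eq_on_lamSite (lam : (j : ℕ) → Site P j → V) :
    ∃ μ : SiteField P 0 V, ∀ (j : ℕ) (y : Site P j), D.LamSite j y → siteAvgIter j μ y = lam j y :=
  ⟨fun x => lam (levOf (fun i => {z : Site P 0 | D.InOm i z}) D.k x) (iterBlockOf (levOf (fun i => {z : Site P 0 | D.InOm i z}) D.k x) x),
    fun _ _ hy => siteAvgIter_levLift D lam hy⟩

end Lift

/-! ## §2  One cell: the coarse gradient of the family versus `Q_j(∂μ)` -/

section Cell

variable {D : Domains P}

/-- **(1.20) AS A DEFECT FORMULA** (no hypothesis): for every fine `μ`, level-`j` function `λ_j` and `j`-bond `b`,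
`∂^{(j)}λ_j(b) − (Q_j(∂^{c₀}μ))(b) = (c₀∕Lʲ)•((λ_j − Q′_jμ)(b₊) − (λ_j − Q′_jμ)(b₋))` (coarse factor `c₀∕Lʲ`). [cite: Balaban1984PropagatorsI, (1.20) p.20, (1.13) p.19] -/
theorem coarseGrad_sub_bondAvgIter_grad (c₀ : ℝ) {j : ℕ} (hj : j ≤ P.m + P.K) (μ : SiteField P 0 V) (lamj : Site P j → V) (b : PBond P j) :
    grad (c₀ / (P.L : ℝ) ^ j) lamj b - bondAvgIter j (grad c₀ μ) b
      = (c₀ / (P.L : ℝ) ^ j) • ((lamj b.tgt - siteAvgIter j μ b.tgt) - (lamj b.src - siteAvgIter j μ b.src)) := by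
  rw [bondAvgIter_grad j hj c₀ μ]
  simp only [grad, ← smul_sub]
  congr 1
  abel

variable {lam : (j : ℕ) → Site P j → V} {μ : SiteField P 0 V}

/-- ★ **INTERIOR CELLS ARE EXACT**: if `Q′_jμ = λ_j` on `Λ_j` and BOTH end-points of the `j`-bond `b` lie in `Λ_j`, then `(Q_j(∂^{c₀}μ))(b) = ∂^{(j)}λ_j(b)`.
[cite: Balaban1984PropagatorsI, (1.20) p.20; Balaban1984PropagatorsII, (2.3) p.224, (2.6)–(2.7) p.224] -/
theorem bondAvgIter_grad_eq_coarseGrad_of_lamSite (hμ : ∀ (j : ℕ) (y : Site P j), D.LamSite j y → siteAvgIter j μ y = lam j y)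
    (c₀ : ℝ) {j : ℕ} {b : PBond P j} (hs : D.LamSite j b.src) (ht : D.LamSite j b.tgt) :
    bondAvgIter j (grad c₀ μ) b = grad (c₀ / (P.L : ℝ) ^ j) (lam j) b := by
  have hj : j ≤ P.m + P.K := (D.le_of_lamSite hs).trans D.hk
  rw [bondAvgIter_grad j hj c₀ μ]
  simp only [grad, hμ j _ hs, hμ j _ ht]

/-- ★ … in the letters of the `Λ_j`-cells of [4] (2.3) (`LamBond`: at least one end-point in `Ω_j^{(j)}`, none inside `Ω_{j+1}`): a cell with BOTH end-points
in `Ω_j^{(j)}` is interior, and there `(Q_j(∂^{c₀}μ))(b) = ∂^{(j)}λ_j(b)`. [cite: Balaban1984PropagatorsII, (2.3) p.224; Balaban1984PropagatorsI, (1.20) p.20] -/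
theorem bondAvgIter_grad_eq_coarseGrad_of_mem_Om (hμ : ∀ (j : ℕ) (y : Site P j), D.LamSite j y → siteAvgIter j μ y = lam j y)
    (c₀ : ℝ) {j : ℕ} {b : PBond P j} (hb : D.LamBond j b) (hs : b.src ∈ D.Om j) (ht : b.tgt ∈ D.Om j) :
    bondAvgIter j (grad c₀ μ) b = grad (c₀ / (P.L : ℝ) ^ j) (lam j) b :=
  bondAvgIter_grad_eq_coarseGrad_of_lamSite hμ c₀ ⟨hs, hb.2.1⟩ ⟨ht, hb.2.2⟩

/-- If the SOURCE lies in `Λ_j`, the defect of the cell is carried by the target alone: `∂^{(j)}λ_j(b) − (Q_j(∂^{c₀}μ))(b) = (c₀∕Lʲ)•(λ_j(b₊) − Q′_jμ(b₊))`.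
[cite: Balaban1984PropagatorsI, (1.20) p.20; Balaban1984PropagatorsII, (2.3) p.224] -/
theorem coarseGrad_sub_bondAvgIter_grad_of_src_lamSite (hμ : ∀ (j : ℕ) (y : Site P j), D.LamSite j y → siteAvgIter j μ y = lam j y)
    (c₀ : ℝ) {j : ℕ} {b : PBond P j} (hs : D.LamSite j b.src) :
    grad (c₀ / (P.L : ℝ) ^ j) (lam j) b - bondAvgIter j (grad c₀ μ) b = (c₀ / (P.L : ℝ) ^ j) • (lam j b.tgt - siteAvgIter j μ b.tgt) := by
  rw [coarseGrad_sub_bondAvgIter_grad c₀ ((D.le_of_lamSite hs).trans D.hk) μ (lam j) b, hμ j _ hs, sub_self, sub_zero]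

/-- If the TARGET lies in `Λ_j`, the defect of the cell is carried by the source alone: `∂^{(j)}λ_j(b) − (Q_j(∂^{c₀}μ))(b) = −(c₀∕Lʲ)•(λ_j(b₋) − Q′_jμ(b₋))`.
[cite: Balaban1984PropagatorsI, (1.20) p.20; Balaban1984PropagatorsII, (2.3) p.224] -/
theorem coarseGrad_sub_bondAvgIter_grad_of_tgt_lamSite (hμ : ∀ (j : ℕ) (y : Site P j), D.LamSite j y → siteAvgIter j μ y = lam j y)
    (c₀ : ℝ) {j : ℕ} {b : PBond P j} (ht : D.LamSite j b.tgt) :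
    grad (c₀ / (P.L : ℝ) ^ j) (lam j) b - bondAvgIter j (grad c₀ μ) b = -((c₀ / (P.L : ℝ) ^ j) • (lam j b.src - siteAvgIter j μ b.src)) := by
  rw [coarseGrad_sub_bondAvgIter_grad c₀ ((D.le_of_lamSite ht).trans D.hk) μ (lam j) b, hμ j _ ht, sub_self, zero_sub, smul_neg]

/-- **AN OUTER CELL, SOURCE OUTSIDE**: a `Λ_j`-cell `b` whose source is NOT in `Ω_j^{(j)}` (then its target is, and lies in `Λ_j`) carries exactly
`−(c₀∕Lʲ)•(λ_j(b₋) − Q′_jμ(b₋))` — the value of the family at the outer end-point against the `j`-block mean of `μ` there.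
[cite: Balaban1984PropagatorsII, (2.3) p.224; Balaban1984PropagatorsI, (1.20) p.20] -/
theorem coarseGrad_sub_bondAvgIter_grad_of_src_not_mem (hμ : ∀ (j : ℕ) (y : Site P j), D.LamSite j y → siteAvgIter j μ y = lam j y)
    (c₀ : ℝ) {j : ℕ} {b : PBond P j} (hb : D.LamBond j b) (hs : b.src ∉ D.Om j) :
    grad (c₀ / (P.L : ℝ) ^ j) (lam j) b - bondAvgIter j (grad c₀ μ) b = -((c₀ / (P.L : ℝ) ^ j) • (lam j b.src - siteAvgIter j μ b.src)) :=
  coarseGrad_sub_bondAvgIter_grad_of_tgt_lamSite hμ c₀ ⟨hb.1.resolve_left hs, hb.2.2⟩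

/-- **AN OUTER CELL, TARGET OUTSIDE**: a `Λ_j`-cell `b` whose target is NOT in `Ω_j^{(j)}` (then its source is, and lies in `Λ_j`) carries exactly
`(c₀∕Lʲ)•(λ_j(b₊) − Q′_jμ(b₊))`. [cite: Balaban1984PropagatorsII, (2.3) p.224; Balaban1984PropagatorsI, (1.20) p.20] -/
theorem coarseGrad_sub_bondAvgIter_grad_of_tgt_not_mem (hμ : ∀ (j : ℕ) (y : Site P j), D.LamSite j y → siteAvgIter j μ y = lam j y)
    (c₀ : ℝ) {j : ℕ} {b : PBond P j} (hb : D.LamBond j b) (ht : b.tgt ∉ D.Om j) :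
    grad (c₀ / (P.L : ℝ) ^ j) (lam j) b - bondAvgIter j (grad c₀ μ) b = (c₀ / (P.L : ℝ) ^ j) • (lam j b.tgt - siteAvgIter j μ b.tgt) :=
  coarseGrad_sub_bondAvgIter_grad_of_src_lamSite hμ c₀ ⟨hb.1.resolve_right ht, hb.2.1⟩

end Cell

/-! ## §3  On `𝔅 = ⋃_j Λ_j`: outer-consistency ⇒ the exact `Q(∂μ)`-form; the defect datum -/

section BondIdxLevel

variable {D : Domains P} {lam : (j : ℕ) → Site P j → V} {μ : SiteField P 0 V}

/-- ★★ **OUTER-CONSISTENCY ⇒ `X = Q(∂^{c₀}μ)` ON ALL OF `𝔅`** — the `hXM` binder of FILE 3's `curlA_extension_eq_zero_of_bondAvgIter_grad` and the `μ₀` of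
dag-n07-w7's `hOp_QE_dE_eq_dE_V1`: if `Q′_jμ = λ_j` on the `Λ_j` (sites) and, at every OUTER end-point `y_out ∉ Ω_j^{(j)}` of a `Λ_j`-cell, the family agrees with
the `j`-block mean of `μ` (`Q′_jμ(y_out) = λ_j(y_out)`), then the coarse pure gauge `X(c) = ∂^{(j(c))}λ_{j(c)}(c)` (coarse factor `c₀∕L^{j(c)}`) IS the multi-level
average of the fine pure gauge `∂^{c₀}μ` at every cell of `𝔅`. [cite: Balaban1984PropagatorsI, (1.20) p.20; Balaban1984PropagatorsII, (2.3)–(2.4) p.224, (2.6)–(2.7) p.224, (2.20) p.226] -/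
theorem bondAvgIter_grad_eq_of_outerConsistent (hμ : ∀ (j : ℕ) (y : Site P j), D.LamSite j y → siteAvgIter j μ y = lam j y)
    (c₀ : ℝ) {X : BondIdx D → V}
    (hX : ∀ c : BondIdx D, X c = grad (c₀ / (P.L : ℝ) ^ (c.1.1 : ℕ)) (lam c.1.1) c.1.2)
    (hout : ∀ c : BondIdx D,
      (c.1.2.src ∉ D.Om c.1.1 → siteAvgIter (c.1.1 : ℕ) μ c.1.2.src = lam c.1.1 c.1.2.src) ∧
      (c.1.2.tgt ∉ D.Om c.1.1 → siteAvgIter (c.1.1 : ℕ) μ c.1.2.tgt = lam c.1.1 c.1.2.tgt)) :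
    ∀ c : BondIdx D, X c = bondAvgIter (c.1.1 : ℕ) (grad c₀ μ) c.1.2 := by
  intro c
  have hb : D.LamBond c.1.1 c.1.2 := c.2
  have hj : (c.1.1 : ℕ) ≤ P.m + P.K := (D.le_of_lamBond hb).trans D.hk
  rw [hX c, ← sub_eq_zero, coarseGrad_sub_bondAvgIter_grad c₀ hj μ (lam c.1.1) c.1.2]
  have hs : lam c.1.1 c.1.2.src - siteAvgIter (c.1.1 : ℕ) μ c.1.2.src = 0 := by
    by_cases h : c.1.2.src ∈ D.Om c.1.1
    · rw [hμ _ _ ⟨h, hb.2.1⟩, sub_self]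
    · rw [(hout c).1 h, sub_self]
  have ht : lam c.1.1 c.1.2.tgt - siteAvgIter (c.1.1 : ℕ) μ c.1.2.tgt = 0 := by
    by_cases h : c.1.2.tgt ∈ D.Om c.1.1
    · rw [hμ _ _ ⟨h, hb.2.2⟩, sub_self]
    · rw [(hout c).2 h, sub_self]
  rw [hs, ht, sub_self, smul_zero]

/-- **WITH THE LEVEL LIFT `μ_λ` ONLY OUTER-CONSISTENCY IS ASKED** (§1 supplies `Q′_jμ_λ = λ_j` on the `Λ_j`): if `λ_j(y_out) = Q′_jμ_λ(y_out)` at the outer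
end-points, then `X = Q(∂^{c₀}μ_λ)` on `𝔅`. [cite: Balaban1984PropagatorsI, (1.20) p.20; Balaban1984PropagatorsII, (2.3)–(2.4) p.224] -/
theorem bondAvgIter_grad_levLift_eq_of_outerConsistent (D : Domains P) (lam : (j : ℕ) → Site P j → V) (c₀ : ℝ) {X : BondIdx D → V}
    (hX : ∀ c : BondIdx D, X c = grad (c₀ / (P.L : ℝ) ^ (c.1.1 : ℕ)) (lam c.1.1) c.1.2)
    (hout : ∀ c : BondIdx D,
      (c.1.2.src ∉ D.Om c.1.1 → siteAvgIter (c.1.1 : ℕ) (fun x => lam (levOf (fun i => {z : Site P 0 | D.InOm i z}) D.k x)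
        (iterBlockOf (levOf (fun i => {z : Site P 0 | D.InOm i z}) D.k x) x)) c.1.2.src = lam c.1.1 c.1.2.src) ∧
      (c.1.2.tgt ∉ D.Om c.1.1 → siteAvgIter (c.1.1 : ℕ) (fun x => lam (levOf (fun i => {z : Site P 0 | D.InOm i z}) D.k x)
        (iterBlockOf (levOf (fun i => {z : Site P 0 | D.InOm i z}) D.k x) x)) c.1.2.tgt = lam c.1.1 c.1.2.tgt)) :
    ∀ c : BondIdx D, X c = bondAvgIter (c.1.1 : ℕ) (grad c₀ (fun x => lam (levOf (fun i => {z : Site P 0 | D.InOm i z}) D.k x)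
      (iterBlockOf (levOf (fun i => {z : Site P 0 | D.InOm i z}) D.k x) x))) c.1.2 :=
  bondAvgIter_grad_eq_of_outerConsistent (fun _ _ hy => siteAvgIter_levLift D lam hy) c₀ hX hout

/-- **BLOCK-MEAN FAMILIES ARE OUTER-CONSISTENT — NON-VACUITY (A6) AND THE [I.4] (1.20) CASE**: for `λ_j := Q′_jM` and `μ := M` both hypotheses of
`bondAvgIter_grad_eq_of_outerConsistent` hold by `rfl` (then its conclusion is (1.20) itself, FILE 4's `…_coarsePureGauge` datum).
[cite: Balaban1984PropagatorsI, (1.20) p.20; Balaban1984PropagatorsII, (2.3) p.224] -/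
theorem outerConsistent_of_blockMean (M : SiteField P 0 V) :
    (∀ (j : ℕ) (y : Site P j), D.LamSite j y → siteAvgIter j M y = (fun i (z : Site P i) => siteAvgIter i M z) j y) ∧
    ∀ c : BondIdx D,
      (c.1.2.src ∉ D.Om c.1.1 → siteAvgIter (c.1.1 : ℕ) M c.1.2.src = (fun i (z : Site P i) => siteAvgIter i M z) c.1.1 c.1.2.src) ∧
      (c.1.2.tgt ∉ D.Om c.1.1 → siteAvgIter (c.1.1 : ℕ) M c.1.2.tgt = (fun i (z : Site P i) => siteAvgIter i M z) c.1.1 c.1.2.tgt) :=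
  ⟨fun _ _ _ => rfl, fun _ => ⟨fun _ => rfl, fun _ => rfl⟩⟩

/-- **THE DEFECT DATUM `X − Q(∂μ)` VANISHES ON THE INTERIOR CELLS** (both end-points in `Ω_j^{(j)}`).
[cite: Balaban1984PropagatorsII, (2.3) p.224; Balaban1984PropagatorsI, (1.20) p.20] -/
theorem sub_bondAvgIter_grad_eq_zero_of_mem_Om (hμ : ∀ (j : ℕ) (y : Site P j), D.LamSite j y → siteAvgIter j μ y = lam j y)
    (c₀ : ℝ) {X : BondIdx D → V}
    (hX : ∀ c : BondIdx D, X c = grad (c₀ / (P.L : ℝ) ^ (c.1.1 : ℕ)) (lam c.1.1) c.1.2)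
    (c : BondIdx D) (hs : c.1.2.src ∈ D.Om c.1.1) (ht : c.1.2.tgt ∈ D.Om c.1.1) :
    X c - bondAvgIter (c.1.1 : ℕ) (grad c₀ μ) c.1.2 = 0 := by
  rw [hX c, bondAvgIter_grad_eq_coarseGrad_of_mem_Om hμ c₀ c.2 hs ht, sub_self]

/-- **THE DEFECT DATUM ON AN OUTER CELL, SOURCE OUTSIDE**: `(X − Q(∂μ))(c) = −(c₀∕Lʲ)•(λ_j(c₋) − Q′_jμ(c₋))`.
[cite: Balaban1984PropagatorsII, (2.3) p.224; Balaban1984PropagatorsI, (1.20) p.20] -/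
theorem sub_bondAvgIter_grad_of_src_not_mem (hμ : ∀ (j : ℕ) (y : Site P j), D.LamSite j y → siteAvgIter j μ y = lam j y)
    (c₀ : ℝ) {X : BondIdx D → V}
    (hX : ∀ c : BondIdx D, X c = grad (c₀ / (P.L : ℝ) ^ (c.1.1 : ℕ)) (lam c.1.1) c.1.2)
    (c : BondIdx D) (hs : c.1.2.src ∉ D.Om c.1.1) :
    X c - bondAvgIter (c.1.1 : ℕ) (grad c₀ μ) c.1.2
      = -((c₀ / (P.L : ℝ) ^ (c.1.1 : ℕ)) • (lam c.1.1 c.1.2.src - siteAvgIter (c.1.1 : ℕ) μ c.1.2.src)) := by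
  rw [hX c]
  exact coarseGrad_sub_bondAvgIter_grad_of_src_not_mem hμ c₀ c.2 hs

/-- **THE DEFECT DATUM ON AN OUTER CELL, TARGET OUTSIDE**: `(X − Q(∂μ))(c) = (c₀∕Lʲ)•(λ_j(c₊) − Q′_jμ(c₊))`.
[cite: Balaban1984PropagatorsII, (2.3) p.224; Balaban1984PropagatorsI, (1.20) p.20] -/
theorem sub_bondAvgIter_grad_of_tgt_not_mem (hμ : ∀ (j : ℕ) (y : Site P j), D.LamSite j y → siteAvgIter j μ y = lam j y)
    (c₀ : ℝ) {X : BondIdx D → V}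
    (hX : ∀ c : BondIdx D, X c = grad (c₀ / (P.L : ℝ) ^ (c.1.1 : ℕ)) (lam c.1.1) c.1.2)
    (c : BondIdx D) (ht : c.1.2.tgt ∉ D.Om c.1.1) :
    X c - bondAvgIter (c.1.1 : ℕ) (grad c₀ μ) c.1.2
      = (c₀ / (P.L : ℝ) ^ (c.1.1 : ℕ)) • (lam c.1.1 c.1.2.tgt - siteAvgIter (c.1.1 : ℕ) μ c.1.2.tgt) := by
  rw [hX c]
  exact coarseGrad_sub_bondAvgIter_grad_of_tgt_not_mem hμ c₀ c.2 ht

end BondIdxLevel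

/-! ## §4  At NODE 00's objects: the curl of `H_V X` only sees the defect datum; outer-consistent families give a curl-free shift -/

section Objects

variable {N : ℕ} {k : ℕ} {D : Domains P}

/-- ★★ **THE CURL OF THE SHIFT ONLY SEES THE DATUM MINUS ANY `Q(∂M)`**: for the componentwise extension `H_V` of `flatH` (kernel formula `hHV`, the head's
binder verbatim), every matrix datum `X : 𝔅 → M_N(ℂ)` and EVERY fine matrix gauge function `M`,
`∂^{η_k}(H_V X)(p_{νμ}(y)) = ∂^{η_k}(H_V(X − Q(∂^{Lᵏ}M)))(p_{νμ}(y))` — FILE 3's `curlA_extension_eq_zero_of_bondAvgIter_grad` for the summand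
`Q(∂^{Lᵏ}M)` and g0's `curlA_add_eq_of_curlFree`.  With `M := μ_λ` (§1) and `X` the coarse gradient of `λ`, the right-hand datum is §3's OUTER-CELL DEFECT.
[cite: Balaban1985Variational, (157) p.302, (168) p.304; Balaban1984PropagatorsII, (2.35) p.228; Balaban1984PropagatorsI, (1.20) p.20] -/
theorem curlA_extension_eq_curlA_extension_sub
    {HV : (BondIdx D → MatA N) →ₗ[ℂ] (PBond P 0 → MatA N)}
    (hHV : ∀ (B : BondIdx D → MatA N) (b : PBond P 0), HV B b = ∑ c, ((flatH P k D (Pi.single c 1) b : ℝ) : ℂ) • B c)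
    (X : BondIdx D → MatA N) (M : Site P 0 → MatA N) (y : Site P 0) (ν μ : Fin P.d) :
    Sect2.curlA (P.eta k) (HV X) y ν μ
      = Sect2.curlA (P.eta k) (HV (fun c => X c - bondAvgIter (c.1.1 : ℕ) (grad ((P.L : ℝ) ^ k) M) c.1.2)) y ν μ := by
  have hsplit : X = (fun c => X c - bondAvgIter (c.1.1 : ℕ) (grad ((P.L : ℝ) ^ k) M) c.1.2)
      + (fun c => bondAvgIter (c.1.1 : ℕ) (grad ((P.L : ℝ) ^ k) M) c.1.2) := by
    funext c
    simp only [Pi.add_apply, sub_add_cancel]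
  conv_lhs => rw [hsplit, map_add]
  exact curlA_add_eq_of_curlFree (P.eta k) _
    (curlA_extension_eq_zero_of_bondAvgIter_grad hHV M (fun _ => rfl)) y ν μ

/-- ★★ **AN OUTER-CONSISTENT COARSE FAMILY GIVES A CURL-FREE SHIFT**: if the matrix datum is the coarse pure gauge of a family `λ = (λ_j)_j`,
`X(c) = ∂^{(j(c))}λ_{j(c)}(c)` (coarse factor `Lᵏ∕L^{j(c)}`), and a fine matrix gauge function `M` has `Q′_jM = λ_j` on the `Λ_j` (§1: the level lift
always does) AND at the outer end-points of the `Λ_j`-cells, then `∂^{η_k}(H_V X) = 0` at every plaquette (§3 ∘ FILE 3).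
[cite: Balaban1985Variational, (157) p.302, (168) p.304; Balaban1984PropagatorsII, (2.3) p.224, (2.35) p.228; Balaban1984PropagatorsI, (1.20) p.20] -/
theorem curlA_extension_eq_zero_of_coarseGradient_outerConsistent
    {HV : (BondIdx D → MatA N) →ₗ[ℂ] (PBond P 0 → MatA N)}
    (hHV : ∀ (B : BondIdx D → MatA N) (b : PBond P 0), HV B b = ∑ c, ((flatH P k D (Pi.single c 1) b : ℝ) : ℂ) • B c)
    {lam : (j : ℕ) → Site P j → MatA N} {M : Site P 0 → MatA N}
    (hM : ∀ (j : ℕ) (y : Site P j), D.LamSite j y → siteAvgIter j M y = lam j y)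
    {X : BondIdx D → MatA N}
    (hX : ∀ c : BondIdx D, X c = grad ((P.L : ℝ) ^ k / (P.L : ℝ) ^ (c.1.1 : ℕ)) (lam c.1.1) c.1.2)
    (hout : ∀ c : BondIdx D,
      (c.1.2.src ∉ D.Om c.1.1 → siteAvgIter (c.1.1 : ℕ) M c.1.2.src = lam c.1.1 c.1.2.src) ∧
      (c.1.2.tgt ∉ D.Om c.1.1 → siteAvgIter (c.1.1 : ℕ) M c.1.2.tgt = lam c.1.1 c.1.2.tgt))
    (y : Site P 0) (ν μ : Fin P.d) :
    Sect2.curlA (P.eta k) (HV X) y ν μ = 0 :=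
  curlA_extension_eq_zero_of_bondAvgIter_grad hHV M (bondAvgIter_grad_eq_of_outerConsistent hM _ hX hout) y ν μ

open scoped Classical in
/-- ★ **THE S6 HEAD's R0′ SPLIT CLAUSE WITH THE SHIFT FROM AN OUTER-CONSISTENT COARSE FAMILY** — FILE 4 §1 `localGaugeSplitOn_of_gauge152_coarsePureGauge`
with its `M`∕`hXM` binder supplied by §3: S3's local gauge `u` of `U` on `Y` with potential `A` and (152) letters `t`, the (159)-splitting
`A − H_V X = A₁ + A₂ − A₃` with `Letters10On` letters `t₁, t₂, t₃`, the datum `X` the coarse pure gauge of an outer-consistent family ⇒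
`LocalGaugeSplitOn Y η_k t (t₁ + t₂ + t₃) U`. [cite: Balaban1985Variational, (152) p.301, (157)–(159) pp.302–303, (165) p.304, (168) p.304; Balaban1984PropagatorsII, (2.3) p.224, (2.35) p.228; Balaban1984PropagatorsI, (1.20) p.20] -/
theorem localGaugeSplitOn_of_gauge152_coarseGradient_outerConsistent [NeZero N] {Y : Set (Site P 0)} {t t₁ t₂ t₃ : ℝ}
    {U : GaugeField P 0 (SU N)} (u : GaugeTransf P 0 (SU N)) {A A₁ A₂ A₃ : PBond P 0 → MatA N}
    {HV : (BondIdx D → MatA N) →ₗ[ℂ] (PBond P 0 → MatA N)}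
    (hHV : ∀ (B : BondIdx D → MatA N) (b : PBond P 0), HV B b = ∑ c, ((flatH P k D (Pi.single c 1) b : ℝ) : ℂ) • B c)
    {lam : (j : ℕ) → Site P j → MatA N} {M : Site P 0 → MatA N}
    (hM : ∀ (j : ℕ) (y : Site P j), D.LamSite j y → siteAvgIter j M y = lam j y)
    {X : BondIdx D → MatA N}
    (hX : ∀ c : BondIdx D, X c = grad ((P.L : ℝ) ^ k / (P.L : ℝ) ^ (c.1.1 : ℕ)) (lam c.1.1) c.1.2)
    (hout : ∀ c : BondIdx D,
      (c.1.2.src ∉ D.Om c.1.1 → siteAvgIter (c.1.1 : ℕ) M c.1.2.src = lam c.1.1 c.1.2.src) ∧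
      (c.1.2.tgt ∉ D.Om c.1.1 → siteAvgIter (c.1.1 : ℕ) M c.1.2.tgt = lam c.1.1 c.1.2.tgt))
    (he : ∀ b ∈ (Sect2.regionOfSet P Y).bonds, gaugeU (fun x => ιSU N (u x)) (fun b' => ιSU N (U b')) b = expI (P.eta k) (A b))
    (hA : ∀ b ∈ (Sect2.regionOfSet P Y).bonds, ‖A b‖ < t)
    (hdA : ∀ q ∈ (Sect2.regionOfSet P Y).dpairs, ‖B12RegularSpaces111.grad (P.eta k) q.2.1 (fun y => A ⟨y, q.2.2⟩) q.1‖ < t)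
    (h159 : ∀ b, A b - HV X b = A₁ b + A₂ b - A₃ b)
    (h₁ : Letters10On Y (P.eta k) t₁ A₁) (h₂ : Letters10On Y (P.eta k) t₂ A₂) (h₃ : Letters10On Y (P.eta k) t₃ A₃) :
    LocalGaugeSplitOn Y (P.eta k) t (t₁ + t₂ + t₃) U :=
  localGaugeSplitOn_of_gauge152_coarsePureGauge u hHV M (bondAvgIter_grad_eq_of_outerConsistent hM _ hX hout) he hA hdA h159 h₁ h₂ h₃

end Objects

end Summit.QuantumFields.YangMills.BalabanUVNodes.N07CoarseGaugeQForm

end
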